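import Summits.Ventures.HSemireg.WedgeHankelGlue
import Summits.Ventures.HSemireg.WedgePairShear

/-!
# Venture HSemireg — FN4_classLevel assembled

HONEST FRAMING. Part of the Lean index of the computation cell `pub-hsemireg` (seat p3; Sunday enclosure of the
FORMULA-N kernel assets of seats th-7 / th-6, ENCLOSURE-PLAN-p3.md).  Finite-dimensional exterior algebra over a field ONLY:
no variety, no cohomology theory, no semiregularity map is constructed here; nothing here says that HC / HC_CM / HC_AV holds;
no Literature fact is declared or used.  The geometric DICTIONARY (why these ranks are the `HT`-side box ranks of the cell's
STRUCTURE.md §1 / theory/FORMULA-N.md) lives in theory/FORMULA-N-th7.md PART B §A.3 / §N and is NOT asserted in Lean.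

th-6's `FN4_classLevel` (FORMULA-N §7 FN-4 (i): the Hankel law with its two named rank-2 instances, `FormulaNStatement.lean`) as ONE
tree theorem, assembled from th-7's `WedgeHankelGlue.hankelLaw` (conjunct 1), `WedgePairShear.FN4_transversePair_clause` (conjunct 2,
under th-6 v2's `1 ≤ n` guard) and `WedgePairGlue.FN4_pointPair_clause` (conjunct 3).  Nothing else.
-/

namespace Summit.Ventures.HSemireg.FormulaN

/-- **FN-4 (i), class level, as ONE theorem**: th-6's `FN4_classLevel` = HankelLaw ∧ (transverse-pair law, `1 ≤ n`) ∧ (point-pair law) —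
all three conjuncts are th-7's kernel theorems (`Wedge.Hankel.hankelLaw`, `WedgePairGlue.FN4_transversePair_clause`,
`WedgePairGlue.FN4_pointPair_clause`). -/
theorem fn4_classLevel : FN4_classLevel :=
  ⟨Wedge.Hankel.hankelLaw, WedgePairGlue.FN4_transversePair_clause, WedgePairGlue.FN4_pointPair_clause⟩

end Summit.Ventures.HSemireg.FormulaN
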